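import Summits.KontsevichZagierPeriods.KontsevichZagierPeriods.Theorems.SoloInformedQuadraticRadical
import Summits.KontsevichZagierPeriods.KontsevichZagierPeriods.Theorems.SoloInformedAlgBoxSplit
import HarnessLib
import HarnessLib.Audit

/-!
# SoloInformed — `K`-affine substitutions; the period conjecture for `(A + B√q)/C`, `q` any quadratic over `K` in normal form

Solo programme `solo-KontsevichZagierPeriods-informed`, session s112, file 30.

The affine substitution `x = β + αu` with `α, β ∈ K` (real algebraic), `α ≠ 0`, is ONE move of
rule (2): its graph is `ℚ`-semialgebraic because `K`-polynomial maps are (`LEMMA ALG-COEFF`,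
`soloInformed_isSemialgebraicMapOn_scaleMoveK`), and the generic substitution lemma of file 26
applies (`soloInformed_exists_affineSubst`).  Every quadratic `q ∈ K[x]` with `a = lc(q) ≠ 0` is
`a·((x − β)² + α²)`, `a·(α² − (x − β)²)·(−1)…` — precisely, up to the factor `√|a| ∈ K` absorbed
into `B`, `√q` is one of `√((x − β)² + α²)`, `√(α² − (x − β)²)`, `√((x − β)² − α²)` with
`α > 0`, `β ∈ K` (`α² = |Δ|/(4a²)`, `β = −b/(2a)`; `Δ = 0` gives `|x − β|`, a piecewise-polynomial
case covered by file 20).  After `x = β + αu` these are `α√(1 + u²)`, `α√(1 − u²)`, `α√(u² − 1)`,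
so file 29 applies.  THEOREM `soloInformed_kzp_sqrtQuadratic`: **the Kontsevich–Zagier period
conjecture holds between any two absolutely convergent one-variable integrals of integrands
`(A(x) + B(x)√q(x))/C(x)`, `A, B, C ∈ K[X]`, `q` a quadratic over `K` in one of the three normal
forms (domains: arbitrary; `⊆ (β − α, β + α]`; `⊆ [β + α, ∞)`), and between these and the
`K`-rational class / rational representations of dimension `≤ 1`, whenever the values agree.**

References: M. Kontsevich, D. Zagier, *Periods* (2001), §1.1–1.2; A. Baker (1975), Thm. 2.1;
Bochnak–Coste–Roy (1998), Prop. 2.2.6.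
-/

noncomputable section

open scoped BigOperators Polynomial

namespace Summit.KontsevichZagierPeriods.KontsevichZagierPeriods.Theorems

open Set MeasureTheory
open Literature.ModelTheory.ExponentialFields
open Literature.NumberTheory.Transcendental Literature.NumberTheory.Transcendental.KZ

/-- Elements of `K = algebraicClosure ℚ ℝ` are algebraic reals. -/
theorem soloInformed_isAlgebraic_algebraMap_K (c : algebraicClosure ℚ ℝ) :
    IsAlgebraic ℚ (algebraMap (algebraicClosure ℚ ℝ) ℝ c) :=
  mem_algebraicClosure_iff.mp c.2

/-! ## The `K`-affine move -/

/-- **`K`-affine substitution as one move:** for `α, β ∈ K`, `α ≠ 0`, and any representation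
`R = [D, f]` of dimension `1`, `R' = [{u | β + αu ∈ D}, f(β + αu)·|α|]` is a representation and
`[R'] − [R] ∈ changeOfVariablesRel`. [Kontsevich–Zagier 2001, §1.2 rule (2)] -/
theorem soloInformed_exists_affineSubst (α β : algebraicClosure ℚ ℝ)
    (hα : algebraMap (algebraicClosure ℚ ℝ) ℝ α ≠ 0) (R : IntegralRep 1) :
    ∃ R' : IntegralRep 1,
      R'.domain = {u | u ∈ (univ : Set (Fin 1 → ℝ)) ∧
        soloInformedScaleMoveR 0 (algebraMap _ ℝ β) (algebraMap _ ℝ α) u ∈ R.domain} ∧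
      (R'.integrand = fun u => R.integrand (soloInformedScaleMoveR 0 (algebraMap _ ℝ β)
        (algebraMap _ ℝ α) u) * |(soloInformedScaleDerivR (n := 1) 0 (algebraMap _ ℝ α)).det|) ∧
      of R' - of R ∈ changeOfVariablesRel := by
  refine soloInformed_exists_subst _ (fun _ => soloInformedScaleDerivR (n := 1) 0 (algebraMap _ ℝ α))
    (soloInformed_isSemialgebraicMapOn_scaleMoveK soloInformed_isAlgebraic_algebraMap_K 0 β α
      isSemialgebraic_univ)
    (fun u _ => soloInformed_hasFDerivAt_scaleMoveR 0 _ _ u)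
    ((soloInformed_scaleMoveR_injective 0 hα).injOn)
    ((isSemialgebraicFunOn_const_of_isAlgebraic isSemialgebraic_univ
      (c := |algebraMap (algebraicClosure ℚ ℝ) ℝ α|) ?_).congr fun u _ => by
        rw [soloInformed_det_scaleDerivR])
    R fun x _ => ⟨fun _ => (x 0 - algebraMap _ ℝ β) / algebraMap _ ℝ α, mem_univ _, ?_⟩
  · rcases le_or_gt 0 (algebraMap (algebraicClosure ℚ ℝ) ℝ α) with h | h
    · rw [abs_of_nonneg h]; exact soloInformed_isAlgebraic_algebraMap_K α
    · rw [abs_of_neg h]; exact (soloInformed_isAlgebraic_algebraMap_K α).neg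
  · funext j
    rw [Fin.fin_one_eq_zero j, soloInformed_scaleMoveR_apply_self]
    field_simp
    ring

/-- Pointwise data of the affine move: the new point is `β + αu`, the Jacobian factor is `|α|`. -/
theorem soloInformed_affine_apply (α β : ℝ) (u : Fin 1 → ℝ) :
    soloInformedScaleMoveR 0 β α u 0 = β + α * u 0 ∧
      |(soloInformedScaleDerivR (n := 1) 0 α).det| = |α| := by
  rw [soloInformed_scaleMoveR_apply_self, soloInformed_det_scaleDerivR]
  exact ⟨rfl, rfl⟩

/-! ## The three normal forms -/

/-- The affine pre-composition `P ↦ P(β + αX)`. -/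
def soloInformedAffComp (α β : algebraicClosure ℚ ℝ) (P : (algebraicClosure ℚ ℝ)[X]) :
    (algebraicClosure ℚ ℝ)[X] :=
  P.comp (Polynomial.C β + Polynomial.C α * Polynomial.X)

/-- `(P(β + αX))(u) = P(β + αu)`. -/
theorem soloInformed_aeval_affComp (α β : algebraicClosure ℚ ℝ) (P : (algebraicClosure ℚ ℝ)[X]) (u : ℝ) :
    (Polynomial.aeval u (soloInformedAffComp α β P) : ℝ) =
      Polynomial.aeval (algebraMap _ ℝ β + algebraMap _ ℝ α * u) P := by
  unfold soloInformedAffComp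
  rw [Polynomial.aeval_comp]
  simp

/-- Common core of the three cases: after `x = β + αu` (`α > 0`) an integrand
`(A(x) + B(x)·(α·s(u)))/C(x)` becomes `(A'(u) + B'(u)·s(u))/C'(u)` with
`A' = α·A(β+αX)`, `B' = α²·B(β+αX)`, `C' = C(β+αX)`. -/
theorem soloInformed_affine_integrand (α β : algebraicClosure ℚ ℝ) (A B C : (algebraicClosure ℚ ℝ)[X])
    (u s : ℝ) :
    ((Polynomial.aeval (algebraMap _ ℝ β + algebraMap _ ℝ α * u) A : ℝ) +
        Polynomial.aeval (algebraMap _ ℝ β + algebraMap _ ℝ α * u) B * (algebraMap _ ℝ α * s)) /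
        Polynomial.aeval (algebraMap _ ℝ β + algebraMap _ ℝ α * u) C * |algebraMap (algebraicClosure ℚ ℝ) ℝ α| =
      ((Polynomial.aeval u (Polynomial.C |α| * soloInformedAffComp α β A) : ℝ) +
        Polynomial.aeval u (Polynomial.C |α| * Polynomial.C α * soloInformedAffComp α β B) * s) /
        Polynomial.aeval u (soloInformedAffComp α β C) := by
  have habs : (algebraMap (algebraicClosure ℚ ℝ) ℝ |α| : ℝ) = |algebraMap (algebraicClosure ℚ ℝ) ℝ α| := by
    rcases le_or_gt 0 α with h | h
    · rw [abs_of_nonneg h, abs_of_nonneg]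
      exact_mod_cast h
    · rw [abs_of_neg h, map_neg, abs_of_neg]
      exact_mod_cast h
  simp only [map_mul, Polynomial.aeval_C, soloInformed_aeval_affComp, habs]
  rw [div_mul_eq_mul_div]
  ring

/-- `r` has integrand `(A + B√q)/C` with `q` a quadratic over `K` in one of the three normal forms
`(x − β)² + α²` (any domain), `α² − (x − β)²` (domain `⊆ (β − α, β + α]`), `(x − β)² − α²`
(domain `⊆ [β + α, ∞)`), `α > 0`, and `C ≠ 0` on the domain. -/
def SoloInformedIsKSqrtQuadraticOne (r : IntegralRep 1) : Prop :=
  ∃ (α β : algebraicClosure ℚ ℝ) (A B C : (algebraicClosure ℚ ℝ)[X]),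
    0 < algebraMap _ ℝ α ∧ (∀ x ∈ r.domain, (Polynomial.aeval (x 0) C : ℝ) ≠ 0) ∧
    ( EqOn r.integrand (fun x => ((Polynomial.aeval (x 0) A : ℝ) + Polynomial.aeval (x 0) B *
          Real.sqrt ((x 0 - algebraMap _ ℝ β) ^ 2 + (algebraMap _ ℝ α) ^ 2)) /
          Polynomial.aeval (x 0) C) r.domain ∨
      ((∀ x ∈ r.domain, algebraMap _ ℝ β - algebraMap _ ℝ α < x 0 ∧
          x 0 ≤ algebraMap _ ℝ β + algebraMap _ ℝ α) ∧
        EqOn r.integrand (fun x => ((Polynomial.aeval (x 0) A : ℝ) + Polynomial.aeval (x 0) B *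
          Real.sqrt ((algebraMap _ ℝ α) ^ 2 - (x 0 - algebraMap _ ℝ β) ^ 2)) /
          Polynomial.aeval (x 0) C) r.domain) ∨
      ((∀ x ∈ r.domain, algebraMap _ ℝ β + algebraMap _ ℝ α ≤ x 0) ∧
        EqOn r.integrand (fun x => ((Polynomial.aeval (x 0) A : ℝ) + Polynomial.aeval (x 0) B *
          Real.sqrt ((x 0 - algebraMap _ ℝ β) ^ 2 - (algebraMap _ ℝ α) ^ 2)) /
          Polynomial.aeval (x 0) C) r.domain) )

/-- **Members of the class lie in the span of points and segments** (one `K`-affine move, then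
file 29). -/
theorem soloInformed_segSpan_of_isKSqrtQuadraticOne (r : IntegralRep 1)
    (hr : SoloInformedIsKSqrtQuadraticOne r) : of r ∈ soloInformedSegSpan := by
  obtain ⟨α, β, A, B, C, hα, hC, hcases⟩ := hr
  obtain ⟨R', hdom, hint, hrel⟩ := soloInformed_exists_affineSubst α β hα.ne' r
  refine soloInformed_segSpan_of_subst hrel (soloInformed_segSpan_of_isKQuadRadicalOne R' ?_)
  -- notation-free abbreviations
  have hmem : ∀ u ∈ R'.domain,
      soloInformedScaleMoveR 0 (algebraMap _ ℝ β) (algebraMap _ ℝ α) u ∈ r.domain := fun u hu => by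
    rw [hdom] at hu; exact hu.2
  have hpt : ∀ u : Fin 1 → ℝ, soloInformedScaleMoveR 0 (algebraMap _ ℝ β) (algebraMap _ ℝ α) u 0 =
      algebraMap _ ℝ β + algebraMap _ ℝ α * u 0 := fun u => (soloInformed_affine_apply _ _ u).1
  have hdet : |(soloInformedScaleDerivR (n := 1) 0 (algebraMap (algebraicClosure ℚ ℝ) ℝ α)).det| =
      |algebraMap (algebraicClosure ℚ ℝ) ℝ α| :=
    (soloInformed_affine_apply (algebraMap _ ℝ α) (algebraMap (algebraicClosure ℚ ℝ) ℝ β) 0).2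
  have hC' : ∀ u ∈ R'.domain, (Polynomial.aeval (u 0) (soloInformedAffComp α β C) : ℝ) ≠ 0 :=
    fun u hu => by
      rw [soloInformed_aeval_affComp, ← hpt u]
      exact hC _ (hmem u hu)
  have hsqα : Real.sqrt ((algebraMap (algebraicClosure ℚ ℝ) ℝ α) ^ 2) = algebraMap _ ℝ α :=
    Real.sqrt_sq hα.le
  -- the integrand of `R'` at `u`, as a function of `x = β + αu`
  have hval : ∀ u ∈ R'.domain, R'.integrand u =
      r.integrand (soloInformedScaleMoveR 0 (algebraMap _ ℝ β) (algebraMap _ ℝ α) u) *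
        |algebraMap (algebraicClosure ℚ ℝ) ℝ α| := fun u _ => by rw [hint, hdet]
  rcases hcases with hf | ⟨hD, hf⟩ | ⟨hD, hf⟩
  · -- `(x − β)² + α² = α²(1 + u²)`
    refine Or.inr (Or.inl (soloInformed_isKHypOne_of_sqrt_rational R' (Polynomial.C |α| * soloInformedAffComp α β A)
      (Polynomial.C |α| * Polynomial.C α * soloInformedAffComp α β B) (soloInformedAffComp α β C) hC' fun u hu => ?_))
    rw [hval u hu, hf (hmem u hu)]
    show ((Polynomial.aeval (soloInformedScaleMoveR 0 _ _ u 0) A : ℝ) +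
        Polynomial.aeval (soloInformedScaleMoveR 0 _ _ u 0) B *
          Real.sqrt ((soloInformedScaleMoveR 0 _ _ u 0 - algebraMap _ ℝ β) ^ 2 + (algebraMap _ ℝ α) ^ 2)) /
        Polynomial.aeval (soloInformedScaleMoveR 0 _ _ u 0) C * |algebraMap (algebraicClosure ℚ ℝ) ℝ α| = _
    have hs : Real.sqrt ((soloInformedScaleMoveR 0 (algebraMap _ ℝ β) (algebraMap _ ℝ α) u 0 -
        algebraMap _ ℝ β) ^ 2 + (algebraMap _ ℝ α) ^ 2) =
        algebraMap _ ℝ α * Real.sqrt (1 + u 0 ^ 2) := by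
      rw [hpt, show (algebraMap (algebraicClosure ℚ ℝ) ℝ β + algebraMap _ ℝ α * u 0 - algebraMap _ ℝ β) ^ 2 +
          (algebraMap _ ℝ α) ^ 2 = (algebraMap _ ℝ α) ^ 2 * (1 + u 0 ^ 2) by ring,
        Real.sqrt_mul (sq_nonneg _), hsqα]
    rw [hs, hpt]
    exact soloInformed_affine_integrand α β A B C (u 0) _
  · -- `α² − (x − β)² = α²(1 − u²)`, `u ∈ (−1, 1]`
    refine Or.inl (soloInformed_isKCircleOne_of_sqrt_rational R' (Polynomial.C |α| * soloInformedAffComp α β A)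
      (Polynomial.C |α| * Polynomial.C α * soloInformedAffComp α β B) (soloInformedAffComp α β C) (fun u hu => ?_) fun u hu => ?_)
    · obtain ⟨h1, h2⟩ := hD _ (hmem u hu)
      rw [hpt] at h1 h2
      refine ⟨?_, ?_, hC' u hu⟩
      · by_contra h
        have : algebraMap (algebraicClosure ℚ ℝ) ℝ α * u 0 ≤ algebraMap _ ℝ α * (-1) :=
          mul_le_mul_of_nonneg_left (not_lt.mp h) hα.le
        linarith
      · by_contra h
        have : algebraMap (algebraicClosure ℚ ℝ) ℝ α * 1 < algebraMap _ ℝ α * u 0 :=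
          mul_lt_mul_of_pos_left (not_le.mp h) hα
        linarith
    · rw [hval u hu, hf (hmem u hu)]
      show ((Polynomial.aeval (soloInformedScaleMoveR 0 _ _ u 0) A : ℝ) +
          Polynomial.aeval (soloInformedScaleMoveR 0 _ _ u 0) B *
            Real.sqrt ((algebraMap _ ℝ α) ^ 2 - (soloInformedScaleMoveR 0 _ _ u 0 - algebraMap _ ℝ β) ^ 2)) /
          Polynomial.aeval (soloInformedScaleMoveR 0 _ _ u 0) C * |algebraMap (algebraicClosure ℚ ℝ) ℝ α| = _
      have hs : Real.sqrt ((algebraMap _ ℝ α) ^ 2 - (soloInformedScaleMoveR 0 (algebraMap _ ℝ β)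
          (algebraMap _ ℝ α) u 0 - algebraMap _ ℝ β) ^ 2) =
          algebraMap _ ℝ α * Real.sqrt (1 - u 0 ^ 2) := by
        rw [hpt, show (algebraMap (algebraicClosure ℚ ℝ) ℝ α) ^ 2 - (algebraMap (algebraicClosure ℚ ℝ) ℝ β +
            algebraMap _ ℝ α * u 0 - algebraMap _ ℝ β) ^ 2 = (algebraMap _ ℝ α) ^ 2 * (1 - u 0 ^ 2) by ring,
          Real.sqrt_mul (sq_nonneg _), hsqα]
      rw [hs, hpt]
      exact soloInformed_affine_integrand α β A B C (u 0) _
  · -- `(x − β)² − α² = α²(u² − 1)`, `u ≥ 1`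
    refine Or.inr (Or.inr (soloInformed_isKHypTwoOne_of_sqrt_rational R' (Polynomial.C |α| * soloInformedAffComp α β A)
      (Polynomial.C |α| * Polynomial.C α * soloInformedAffComp α β B) (soloInformedAffComp α β C) (fun u hu => ?_)
      fun u hu => ?_))
    · have h1 := hD _ (hmem u hu)
      rw [hpt] at h1
      refine ⟨?_, hC' u hu⟩
      by_contra h
      have : algebraMap (algebraicClosure ℚ ℝ) ℝ α * u 0 < algebraMap _ ℝ α * 1 :=
        mul_lt_mul_of_pos_left (not_le.mp h) hα
      linarith
    · rw [hval u hu, hf (hmem u hu)]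
      show ((Polynomial.aeval (soloInformedScaleMoveR 0 _ _ u 0) A : ℝ) +
          Polynomial.aeval (soloInformedScaleMoveR 0 _ _ u 0) B *
            Real.sqrt ((soloInformedScaleMoveR 0 _ _ u 0 - algebraMap _ ℝ β) ^ 2 - (algebraMap _ ℝ α) ^ 2)) /
          Polynomial.aeval (soloInformedScaleMoveR 0 _ _ u 0) C * |algebraMap (algebraicClosure ℚ ℝ) ℝ α| = _
      have hs : Real.sqrt ((soloInformedScaleMoveR 0 (algebraMap _ ℝ β) (algebraMap _ ℝ α) u 0 -
          algebraMap _ ℝ β) ^ 2 - (algebraMap _ ℝ α) ^ 2) =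
          algebraMap _ ℝ α * Real.sqrt (u 0 ^ 2 - 1) := by
        rw [hpt, show (algebraMap (algebraicClosure ℚ ℝ) ℝ β + algebraMap _ ℝ α * u 0 - algebraMap _ ℝ β) ^ 2 -
            (algebraMap _ ℝ α) ^ 2 = (algebraMap _ ℝ α) ^ 2 * (u 0 ^ 2 - 1) by ring,
          Real.sqrt_mul (sq_nonneg _), hsqα]
      rw [hs, hpt]
      exact soloInformed_affine_integrand α β A B C (u 0) _

/-- **The Kontsevich–Zagier period conjecture for one-variable integrands `(A + B√q)/C` with
`A, B, C ∈ K[X]` and `q` a quadratic over `K` in normal form** (see `SoloInformedIsKSqrtQuadraticOne`),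
and against the `K`-rational class and rational representations of dimension `≤ 1`.
Unconditional. [Kontsevich–Zagier 2001, §1.2 Question 1; this work] -/
theorem soloInformed_kzp_sqrtQuadratic (r r' : IntegralRep 1) (hr : SoloInformedIsKSqrtQuadraticOne r)
    (hr' : SoloInformedIsKSqrtQuadraticOne r') :
    (r.value = r'.value → Equivalent r r') ∧
    (∀ r₁ : IntegralRep 1, SoloInformedIsKQuadRadicalOne r₁ → r.value = r₁.value → Equivalent r r₁) ∧
    (∀ r₁ : IntegralRep 1, SoloInformedIsKRationalOne r₁ → r.value = r₁.value → Equivalent r r₁) ∧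
    (∀ {n : ℕ} (hn : n ≤ 1) (r₀ : IntegralRep n), r₀.IsRational → r.value = r₀.value →
      Equivalent r r₀) := by
  have h := soloInformed_segSpan_of_isKSqrtQuadraticOne r hr
  exact ⟨fun hv => soloInformed_equivalent_of_mem_segSpan h
      (soloInformed_segSpan_of_isKSqrtQuadraticOne r' hr') hv,
    fun r₁ hr₁ hv => soloInformed_equivalent_of_mem_segSpan h
      (soloInformed_segSpan_of_isKQuadRadicalOne r₁ hr₁) hv,
    fun r₁ hr₁ hv => soloInformed_equivalent_of_mem_segSpan h
      (soloInformed_segSpan_of_isKRationalOne r₁ hr₁) hv,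
    fun hn r₀ hr₀ hv => soloInformed_equivalent_of_mem_segSpan h
      (soloInformed_of_mem_segSpan_of_isRational hn r₀ hr₀) hv⟩

end Summit.KontsevichZagierPeriods.KontsevichZagierPeriods.Theorems
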